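import Summits.RiemannHypothesis.RiemannHypothesis.Theses.LiDirichletAsymptotic
import Summits.RiemannHypothesis.RiemannHypothesis.Theorems.LiDirichletAsymptoticLiBoxTwoSidedChar
import Summits.RiemannHypothesis.RiemannHypothesis.Theorems.LiDirichletAsymptoticLiSmoothMainTermChar
import Summits.RiemannHypothesis.RiemannHypothesis.Theorems.LiDirichletAsymptoticLiOscillatoryChar
import Summits.RiemannHypothesis.RiemannHypothesis.Theorems.LiDirichletAsymptoticLiBudgetChar
import Summits.RiemannHypothesis.RiemannHypothesis.Theorems.LiDirichletAsymptoticLiLowZerosChar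
import Summits.RiemannHypothesis.RiemannHypothesis.Theorems.LiDirichletAsymptoticLiFarTailsChar
import Summits.RiemannHypothesis.RiemannHypothesis.Theorems.LiDirichletAsymptoticAssembly
import HarnessLib

/-!
# RiemannHypothesis / LiDirichletAsymptotic — CAPSTONE: the Dirichlet Li asymptotic law in the verified range is a
# theorem (RH-FREE · GRH-FREE)

RH-FREE · GRH-FREE PROOF-OF-DATA (rung L-P(P1⁺χ)) [rh-li-prover].  Route `Theses/LiDirichletAsymptotic.lean`
(cell `pub/rh-li`, round 5 (iii)): the route's `closes` composition applied to the seven landed binders —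
`liBoxTwoSidedChar_proof` (K1χ, g4), `liSmoothMainTermChar_proof` (K2χ, g4), `liOscillatoryChar_proof` (K3χ, deciding;
conjuncts by dir-p3 on g4's counting/window infrastructure), `liBudgetChar_proof` (K4χ, dir-p2), `liLowZerosChar_proof`
(S1χ, g4), `liFarTailsChar_proof` (S2χ, dir-p2), `liDirichletAsymptotic_assembly_proof` (Assembly, g3) — gives the LEAF

  `LiTheory.LiDirichletAsymptoticLaw`: for `χ` primitive mod `q > 1`, if every zero of `L(s, χ)` with `|Im ρ| ≤ T`
  (`T ≥ 1000`) lies on the critical line, then for all `n ≤ T²/4`: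
  `|Re λ_χ(n) − (n/2) log n − C₁ n − (n/2) log q| ≤ 15 √n log(qn)` (`n ≥ 10⁴`, tree constants), and
  `≤ √n log(qn)` (`n ≥ 900`) GIVEN Bennett–Martin–O'Bryant–Rechnitzer's Theorem 1.1 (named fact, hypothesis only);

and its corollary at Platt's verified height `LiTheory.LiDirichletAsymptoticPlatt` (GIVEN Platt 2016 Thm 7.1 and BMOR
Thm 1.1 as hypotheses: `q ≤ 10⁵`, `900 ≤ n ≤ 2.5·10¹⁵/q²`).  A FINITE verified height, uniform in the conductor:
a proof of data, not of GRH; nothing here bears on the truth of RH or GRH.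
-/

noncomputable section

-- D-0017: `Summit.<S>.<S>.…` is the designed namespace of a single-problem summit.
set_option linter.dupNamespace false

namespace Summit.RiemannHypothesis.RiemannHypothesis.Theorems.LiTheory

open Literature.NumberTheory.LFunctions Literature.NumberTheory.LFunctions.ExplicitPsiChar

open Summit.RiemannHypothesis.RiemannHypothesis.Theses.LiDirichletAsymptotic in
/-- **The Dirichlet Li asymptotic law in the verified range (LEAF of route `LiDirichletAsymptotic`, rung L-P(P1⁺χ);
RH-FREE · GRH-FREE).**  `LiDirichletAsymptoticLaw` is a theorem: the route's `closes` applied to the seven landed binders. -/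
theorem liDirichletAsymptoticLaw_proof : LiDirichletAsymptoticLaw :=
  closes liBoxTwoSidedChar_proof liSmoothMainTermChar_proof liOscillatoryChar_proof liBudgetChar_proof
    liLowZerosChar_proof liFarTailsChar_proof liDirichletAsymptotic_assembly_proof

/-- **Corollary at Platt's height** (`LiDirichletAsymptoticPlatt`; RH-FREE · GRH-FREE, both named facts as hypotheses):
given Platt 2016 Thm 7.1 and BMOR 2021 Thm 1.1, `|Re λ_χ(n) − charLiMainTerm q n| ≤ √n log(qn)` for every primitive `χ`
mod `1 < q ≤ 10⁵` and `900 ≤ n ≤ ¼(10⁸/q)²` (Platt gives GRH(χ) to height `10⁸/q ≥ 1000`). -/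
theorem liDirichletAsymptoticPlatt_holds : LiDirichletAsymptoticPlatt := by
  intro hP hB q _ χ hχ hq hq5 n hn hnT
  have hχ1 : χ ≠ 1 := ne_one_of_isPrimitive hχ hq
  have hq0 : (0 : ℝ) < q := by exact_mod_cast lt_trans zero_lt_one hq
  have hq5' : (q : ℝ) ≤ 100000 := by exact_mod_cast hq5
  have hT : (1000 : ℝ) ≤ 10 ^ 8 / (q : ℝ) := by
    rw [le_div_iff₀ hq0]; nlinarith
  have hRH : LFunctionRHUpTo χ (10 ^ 8 / (q : ℝ)) :=
    grhUpTo_of_platt2016 hP (le_trans hq5 (by norm_num)) χ hχ1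
  exact (liDirichletAsymptoticLaw_proof q χ hχ hq hT hRH hnT).2 hB hn

end Summit.RiemannHypothesis.RiemannHypothesis.Theorems.LiTheory

end
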